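import Literature.Computability.MetaComplexity.OntoPHPFregeKit
import Literature.Computability.MetaComplexity.FregeBoundedTautology
import HarnessLib

/-!
# PHP-labellings of Boolean variables and the derivation of labelled clauses from `ontoPHP`

Second layer of the reduction of Ben-Sasson 2002 / Krajíček 2019 §15.4 type, from the bijective
pigeonhole principle `ontoPHP^{N+1}_N` to clause sets over labelled variables. A **simple
PHP-labelling** `Λ : PHPLabel` assigns to every Boolean variable `v : ℕ` a constant bit `c v`, at
most one *pigeon-star* `(b, J)` (read: `⋁_{a ∈ J} p_{b,a}`, "pigeon `b` sits in a hole of `J`") and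
at most one *hole-star* `(a, I)` (read: `⋁_{b ∈ I} p_{b,a}`); the substitution `sigma Λ N` sends
`v` to `c v ⊕ [pigeon-star] ⊕ [hole-star]`, rendered as a depth-`3` formula (`render`). Under a
*local bijection* — functions `f` (pigeon ↦ hole) and `g` (hole ↦ pigeon), injective and mutually
inverse on the pigeons and holes labelling a variable set `V` (`ConsistentL`) — the variable `v`
takes the value `val Λ f g v = c v ⊕ [f b ∈ J] ⊕ [g a ∈ I]`.

Main result (`clauseS`): if a clause `C` over `V` is TRUE under `val Λ f g` for every local
bijection `(f, g)` consistent on `V`, then the substituted clause `(clauseOf C).subst (sigma Λ N)`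
is derivable from `ontoPHP` in bounded depth: `⊢ (clauseOf C)σ, ¬R` with polynomially (in `N`)
many lines for `|V|` bounded. Proof: case analysis over the holes of the `≤ |V|` pigeons and the
pigeons of the `≤ |V|` holes that label `V` (`OntoPHPReduction.formsS`); an inconsistent case is
refuted by one hole / functionality clause; in a consistent case every star is decided
(`starPTrueS`, `starPFalseS`, `starHTrueS`, `starHFalseS`) and the clause follows from the decided
stars by a constant-size tautology (the *skeleton*, `TextbookFrege.tautSeqS`) instantiated with the
stars (`TextbookFrege.BD.subst`).

References: E. Ben-Sasson, *Hard examples for the bounded depth Frege proof system*, Comput.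
Complexity 11 (2002) 109–136 (reduction of Tseitin formulas on expanders to the pigeonhole
principle); J. Krajíček, *Proof complexity*, CUP 2019, §15.4, Lemma 15.4.3 (the pattern: substitute,
distribute over local assignments, refute or verify each).
-/

namespace Literature.Computability.MetaComplexity

open Complexity Complexity.PropForm TextbookFrege

open KrajicekRamsey (litOf clauseOf ofCNF_eq_conjList subst_disjList size_subst_le
  altDepthAux_subst_le dd_clauseOf_le msum_map_var)

namespace OntoPHPReduction

/-! ### Labellings -/

/-- A **simple PHP-labelling** of the Boolean variables: a constant bit, an optional pigeon-star
`(b, J)` and an optional hole-star `(a, I)` per variable.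
[cite: KrajicekProofComplexity2019, §15.4 (proof of Lemma 15.4.3: the substitution σ(q_e))] -/
structure PHPLabel where
  /-- the constant bit of the variable -/
  c : ℕ → Bool
  /-- the pigeon-star of the variable: pigeon `b` and hole set `J` -/
  ps : ℕ → Option (ℕ × Finset ℕ)
  /-- the hole-star of the variable: hole `a` and pigeon set `I` -/
  hs : ℕ → Option (ℕ × Finset ℕ)

/-- Well-formedness of a labelling for `N` holes and `N + 1` pigeons. [folklore] -/
def PHPLabel.WF (Λ : PHPLabel) (N : ℕ) : Prop :=
  (∀ v b J, Λ.ps v = some (b, J) → b < N + 1 ∧ ∀ a ∈ J, a < N) ∧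
  (∀ v a I, Λ.hs v = some (a, I) → a < N ∧ ∀ b ∈ I, b < N + 1)

section Defs

variable (N : ℕ)

/-- The pigeon-star formula `⋁_{a ∈ J} p_{b,a}` (holes in increasing order). [cite: KrajicekProofComplexity2019, §15.4] -/
def starP (b : ℕ) (J : Finset ℕ) : PropForm ℕ :=
  disjList ((J.sort (· ≤ ·)).map fun a => pv N b a)

/-- The hole-star formula `⋁_{b ∈ I} p_{b,a}` (pigeons in increasing order). [cite: KrajicekProofComplexity2019, §15.4] -/
def starH (a : ℕ) (I : Finset ℕ) : PropForm ℕ :=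
  disjList ((I.sort (· ≤ ·)).map fun b => pv N b a)

end Defs

/-- Rendering of `c ⊕ X₁ ⊕ ⋯ ⊕ X_k` for `k ≤ 2` inputs as a formula of depth `≤ 3` over the
inputs (longer input lists are not used and render as `⊥`). [folklore] -/
def render (c : Bool) : List (PropForm ℕ) → PropForm ℕ
  | [] => const c
  | [X] => if c then neg X else X
  | [X, Y] => if c then disj (conj X Y) (conj (neg X) (neg Y)) else disj (conj X (neg Y)) (conj (neg X) Y)
  | _ :: _ :: _ :: _ => const false

variable (Λ : PHPLabel) (N : ℕ)

/-- The star formulas of a variable (pigeon-star first). [folklore] -/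
def stars (v : ℕ) : List (PropForm ℕ) :=
  ((Λ.ps v).toList.map fun q => starP N q.1 q.2) ++ ((Λ.hs v).toList.map fun q => starH N q.1 q.2)

/-- **The substitution of a labelling**: `σ(v) = c_v ⊕ [pigeon-star] ⊕ [hole-star]`.
[cite: KrajicekProofComplexity2019, §15.4 (proof of Lemma 15.4.3: σ)] -/
def sigma (v : ℕ) : PropForm ℕ :=
  render (Λ.c v) (stars Λ N v)

/-- The placeholder atoms of a variable: `2v` for its pigeon-star, `2v+1` for its hole-star.
[folklore] -/
def places (v : ℕ) : List (PropForm ℕ) :=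
  ((Λ.ps v).toList.map fun _ => var (2 * v)) ++ ((Λ.hs v).toList.map fun _ => var (2 * v + 1))

/-- The **skeleton** of `σ(v)`: the same rendering over placeholder atoms. [folklore] -/
def skel (v : ℕ) : PropForm ℕ :=
  render (Λ.c v) (places Λ v)

/-- The substitution sending placeholders to stars (identity on unused placeholders).
[folklore] -/
def rho (x : ℕ) : PropForm ℕ :=
  if x % 2 = 0 then
    match Λ.ps (x / 2) with
    | some q => starP N q.1 q.2
    | none => var x
  else
    match Λ.hs (x / 2) with
    | some q => starH N q.1 q.2
    | none => var x

/-- The value of the pigeon-star of `v` under the pigeon map `f` (`false` if there is none).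
[folklore] -/
def pval (f : ℕ → ℕ) (v : ℕ) : Bool :=
  match Λ.ps v with
  | some q => decide (f q.1 ∈ q.2)
  | none => false

/-- The value of the hole-star of `v` under the hole map `g` (`false` if there is none).
[folklore] -/
def hval (g : ℕ → ℕ) (v : ℕ) : Bool :=
  match Λ.hs v with
  | some q => decide (g q.1 ∈ q.2)
  | none => false

/-- The placeholder assignment of a local bijection `(f, g)`. [folklore] -/
def tau0 (f g : ℕ → ℕ) (x : ℕ) : Bool :=
  if x % 2 = 0 then pval Λ f (x / 2) else hval Λ g (x / 2)

/-- **The value of a labelled variable under a local bijection**: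
`c_v ⊕ [f b ∈ J] ⊕ [g a ∈ I]`. [cite: KrajicekProofComplexity2019, §15.4] -/
def val (f g : ℕ → ℕ) (v : ℕ) : Bool :=
  (Λ.c v ^^ pval Λ f v) ^^ hval Λ g v

/-- **Local bijections consistent on a variable list `V`**: the pigeon map `f` and the hole map
`g` take legal values, are injective, and are mutually inverse, on the pigeons and holes that
label the variables of `V`. [cite: KrajicekProofComplexity2019, §15.4 (proof of Lemma 15.4.3: injective assignments)] -/
def ConsistentL (V : List ℕ) (f g : ℕ → ℕ) : Prop :=
  (∀ v ∈ V, ∀ b J, Λ.ps v = some (b, J) → f b < N) ∧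
  (∀ v ∈ V, ∀ a I, Λ.hs v = some (a, I) → g a < N + 1) ∧
  (∀ v ∈ V, ∀ v' ∈ V, ∀ b J b' J', Λ.ps v = some (b, J) → Λ.ps v' = some (b', J') →
    f b = f b' → b = b') ∧
  (∀ v ∈ V, ∀ v' ∈ V, ∀ a I a' I', Λ.hs v = some (a, I) → Λ.hs v' = some (a', I') →
    g a = g a' → a = a') ∧
  (∀ v ∈ V, ∀ v' ∈ V, ∀ b J a I, Λ.ps v = some (b, J) → Λ.hs v' = some (a, I) →
    (f b = a ↔ g a = b))

variable {Λ N}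

/-! ### Arithmetic of placeholders -/

/-- `2v` is even. [folklore] -/
@[simp] theorem two_mul_mod (v : ℕ) : 2 * v % 2 = 0 := by omega

/-- `2v + 1` is odd. [folklore] -/
@[simp] theorem two_mul_add_one_mod (v : ℕ) : (2 * v + 1) % 2 = 1 := by omega

/-- `2v / 2 = v`. [folklore] -/
@[simp] theorem two_mul_div (v : ℕ) : 2 * v / 2 = v := by omega

/-- `(2v + 1) / 2 = v`. [folklore] -/
@[simp] theorem two_mul_add_one_div (v : ℕ) : (2 * v + 1) / 2 = v := by omega

/-! ### Basic facts on rendering -/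

/-- Evaluation of a rendering: the constant bit xor the inputs (at most two). [folklore] -/
theorem eval_render (c : Bool) (τ : ℕ → Bool) :
    ∀ L : List (PropForm ℕ), L.length ≤ 2 →
      (render c L).eval τ = L.foldl (fun b X => b ^^ X.eval τ) c
  | [], _ => by cases c <;> simp [render, eval]
  | [X], _ => by cases c <;> cases hX : X.eval τ <;> simp [render, eval, hX]
  | [X, Y], _ => by
    cases c <;> cases hX : X.eval τ <;> cases hY : Y.eval τ <;> simp [render, eval, hX, hY]
  | _ :: _ :: _ :: _, h => by simp at h

/-- Substitution commutes with rendering. [folklore] -/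
theorem render_subst (c : Bool) (ρ : ℕ → PropForm ℕ) :
    ∀ L : List (PropForm ℕ), (render c L).subst ρ = render c (L.map (PropForm.subst ρ))
  | [] => by cases c <;> rfl
  | [X] => by cases c <;> rfl
  | [X, Y] => by cases c <;> rfl
  | _ :: _ :: _ :: _ => rfl

/-- Size of a rendering. [folklore] -/
theorem size_render_le (c : Bool) {s : ℕ} :
    ∀ L : List (PropForm ℕ), (∀ X ∈ L, X.size ≤ s) → (render c L).size ≤ 2 * s + 2 * s + 7
  | [], _ => by cases c <;> simp [render, size]
  | [X], h => by
    have := h X (by simp)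
    cases c <;> simp only [render, size, if_true, Bool.false_eq_true, if_false] <;> omega
  | [X, Y], h => by
    have := h X (by simp); have := h Y (by simp)
    cases c <;> simp only [render, size, if_true, Bool.false_eq_true, if_false] <;> omega
  | _ :: _ :: _ :: _, _ => by simp [render, size]

/-- Depth of a rendering over inputs of auxiliary depths `≤ t`: all auxiliary depths `≤ t + 3`.
[folklore] -/
theorem altDepthAux_render_le (c : Bool) {t : ℕ} :
    ∀ L : List (PropForm ℕ), (∀ X ∈ L, ∀ k, altDepthAux k X ≤ t) →
      ∀ k, altDepthAux k (render c L) ≤ t + 3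
  | [], _, k => by cases c <;> simp [render]
  | [X], h, k => by
    have h1 := h X (by simp) 1
    have hk := h X (by simp) k
    cases c <;> simp only [render, if_true, Bool.false_eq_true, if_false, altDepthAux] <;>
      (try split_ifs) <;> omega
  | [X, Y], h, k => by
    have hx1 := h X (by simp) 1; have hx2 := h X (by simp) 2
    have hy1 := h Y (by simp) 1; have hy2 := h Y (by simp) 2
    cases c <;> simp only [render, if_true, Bool.false_eq_true, if_false, altDepthAux] <;>
      (try split_ifs) <;> omega
  | _ :: _ :: _ :: _, _, k => by simp [render]

/-- Variables of a rendering are among those of the inputs. [folklore] -/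
theorem mem_vars_render {c : Bool} {x : ℕ} :
    ∀ {L : List (PropForm ℕ)}, x ∈ (render c L).vars → ∃ X ∈ L, x ∈ X.vars
  | [], h => by cases c <;> simp [render, vars] at h
  | [X], h => by
    refine ⟨X, by simp, ?_⟩
    cases c <;> simpa [render, vars] using h
  | [X, Y], h => by
    cases c <;> simp only [render, if_true, Bool.false_eq_true, if_false, vars, Finset.mem_union] at h
    · rcases h with (h | h) | (h | h)
      · exact ⟨X, by simp, h⟩
      · exact ⟨Y, by simp, h⟩
      · exact ⟨X, by simp, h⟩
      · exact ⟨Y, by simp, h⟩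
    · rcases h with (h | h) | (h | h)
      · exact ⟨X, by simp, h⟩
      · exact ⟨Y, by simp, h⟩
      · exact ⟨X, by simp, h⟩
      · exact ⟨Y, by simp, h⟩
  | _ :: _ :: _ :: _, h => by simp [render, vars] at h

/-- Evaluation depends only on the variables of the formula. [folklore] -/
theorem eval_congr_vars {τ τ' : ℕ → Bool} :
    ∀ {φ : PropForm ℕ}, (∀ x ∈ φ.vars, τ x = τ' x) → φ.eval τ = φ.eval τ'
  | var x, h => by simpa [eval, vars] using h x (by simp [vars])
  | const b, _ => rfl
  | neg φ, h => by rw [eval, eval, eval_congr_vars (φ := φ) fun x hx => h x (by simpa [vars] using hx)]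
  | conj φ ψ, h => by
    rw [eval, eval, eval_congr_vars (φ := φ) fun x hx => h x (by simp [vars, hx]),
      eval_congr_vars (φ := ψ) fun x hx => h x (by simp [vars, hx])]
  | disj φ ψ, h => by
    rw [eval, eval, eval_congr_vars (φ := φ) fun x hx => h x (by simp [vars, hx]),
      eval_congr_vars (φ := ψ) fun x hx => h x (by simp [vars, hx])]

/-! ### Basic facts on stars -/

/-- Members of a sorted finset. [folklore] -/
theorem mem_sort_iff {J : Finset ℕ} {a : ℕ} : a ∈ J.sort (· ≤ ·) ↔ a ∈ J := Finset.mem_sort _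

/-- A pigeon-star is a disjunction of atoms. [folklore] -/
theorem starP_atoms (b : ℕ) (J : Finset ℕ) :
    ∀ X ∈ (J.sort (· ≤ ·)).map (fun a => pv N b a), ∃ b' a, X = pv N b' a := by
  intro X hX; obtain ⟨a, -, rfl⟩ := List.mem_map.1 hX; exact ⟨b, a, rfl⟩

/-- A hole-star is a disjunction of atoms. [folklore] -/
theorem starH_atoms (a : ℕ) (I : Finset ℕ) :
    ∀ X ∈ (I.sort (· ≤ ·)).map (fun b => pv N b a), ∃ b a', X = pv N b a' := by
  intro X hX; obtain ⟨b, -, rfl⟩ := List.mem_map.1 hX; exact ⟨b, a, rfl⟩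

/-- Size of a disjunction of atoms. [folklore] -/
theorem size_disjList_atoms {W : List (PropForm ℕ)} (hW : ∀ w ∈ W, ∃ b a, w = pv N b a) :
    (disjList W).size = 2 * W.length + 1 := by
  rw [size_disjList_eq_msum, msum_atoms hW]

/-- Member sum of the negated atoms of a list of atoms. [folklore] -/
theorem msum_map_neg_atoms {W : List (PropForm ℕ)} (hW : ∀ w ∈ W, ∃ b a, w = pv N b a) :
    msum (W.map neg) = 3 * W.length := by
  induction W with
  | nil => simp
  | cons w W ih =>
    obtain ⟨b, a, rfl⟩ := hW w List.mem_cons_self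
    rw [List.map_cons, msum_cons, ih (fun x hx => hW x (List.mem_cons_of_mem _ hx)), List.length_cons]
    simp [size, pv]; omega

/-- All auxiliary depths of a disjunction of atoms are `≤ 1`. [folklore] -/
theorem altDepthAux_disjList_atoms {W : List (PropForm ℕ)} (hW : ∀ w ∈ W, ∃ b a, w = pv N b a)
    (k : ℕ) : altDepthAux k (disjList W) ≤ 1 := by
  have h0 : (disjList W).dd ≤ 0 := dd_disjList_le fun X hX => by
    obtain ⟨b, a, rfl⟩ := hW X hX; simp
  have := altDepthAux_le_dd_succ k (disjList W)
  omega

/-- Size of a pigeon-star with holes `< N`. [folklore] -/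
theorem size_starP_le {b : ℕ} {J : Finset ℕ} (hJ : ∀ a ∈ J, a < N) :
    (starP N b J).size ≤ 2 * N + 1 := by
  rw [starP, size_disjList_atoms (starP_atoms b J), List.length_map, Finset.length_sort]
  have : J.card ≤ N := by
    calc J.card ≤ (Finset.range N).card := Finset.card_le_card fun a ha => Finset.mem_range.2 (hJ a ha)
      _ = N := Finset.card_range N
  omega

/-- Size of a hole-star with pigeons `≤ N`. [folklore] -/
theorem size_starH_le {a : ℕ} {I : Finset ℕ} (hI : ∀ b ∈ I, b < N + 1) :
    (starH N a I).size ≤ 2 * N + 3 := by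
  rw [starH, size_disjList_atoms (starH_atoms a I), List.length_map, Finset.length_sort]
  have : I.card ≤ N + 1 := by
    calc I.card ≤ (Finset.range (N + 1)).card :=
          Finset.card_le_card fun b hb => Finset.mem_range.2 (hI b hb)
      _ = N + 1 := Finset.card_range (N + 1)
  omega

/-- Auxiliary depths of a pigeon-star. [folklore] -/
theorem altDepthAux_starP (b : ℕ) (J : Finset ℕ) (k : ℕ) : altDepthAux k (starP N b J) ≤ 1 :=
  altDepthAux_disjList_atoms (starP_atoms b J) k

/-- Auxiliary depths of a hole-star. [folklore] -/
theorem altDepthAux_starH (a : ℕ) (I : Finset ℕ) (k : ℕ) : altDepthAux k (starH N a I) ≤ 1 :=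
  altDepthAux_disjList_atoms (starH_atoms a I) k

/-- Evaluation of a pigeon-star. [folklore] -/
theorem eval_starP (b : ℕ) (J : Finset ℕ) (τ : ℕ → Bool) :
    (starP N b J).eval τ = true ↔ ∃ a ∈ J, τ (b * N + a) = true := by
  rw [starP, eval_disjList]
  simp only [List.mem_map, mem_sort_iff]
  constructor
  · rintro ⟨_, ⟨a, ha, rfl⟩, h⟩; exact ⟨a, ha, by simpa [pv, eval] using h⟩
  · rintro ⟨a, ha, h⟩; exact ⟨_, ⟨a, ha, rfl⟩, by simpa [pv, eval] using h⟩

/-- Evaluation of a hole-star. [folklore] -/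
theorem eval_starH (a : ℕ) (I : Finset ℕ) (τ : ℕ → Bool) :
    (starH N a I).eval τ = true ↔ ∃ b ∈ I, τ (b * N + a) = true := by
  rw [starH, eval_disjList]
  simp only [List.mem_map, mem_sort_iff]
  constructor
  · rintro ⟨_, ⟨b, hb, rfl⟩, h⟩; exact ⟨b, hb, by simpa [pv, eval] using h⟩
  · rintro ⟨b, hb, h⟩; exact ⟨_, ⟨b, hb, rfl⟩, by simpa [pv, eval] using h⟩

/-! ### The substitution, the skeleton and their relation -/

/-- At most two stars per variable. [folklore] -/
theorem length_stars_le (v : ℕ) : (stars Λ N v).length ≤ 2 := by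
  unfold stars
  rw [List.length_append, List.length_map, List.length_map]
  cases Λ.ps v <;> cases Λ.hs v <;> simp

/-- At most two placeholders per variable. [folklore] -/
theorem length_places_le (v : ℕ) : (places Λ v).length ≤ 2 := by
  unfold places
  rw [List.length_append, List.length_map, List.length_map]
  cases Λ.ps v <;> cases Λ.hs v <;> simp

/-- The stars of a variable are shallow. [folklore] -/
theorem altDepthAux_of_mem_stars {v : ℕ} {X : PropForm ℕ} (hX : X ∈ stars Λ N v) (k : ℕ) :
    altDepthAux k X ≤ 1 := by
  simp only [stars, List.mem_append, List.mem_map, Option.mem_toList] at hX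
  rcases hX with ⟨q, -, rfl⟩ | ⟨q, -, rfl⟩
  · exact altDepthAux_starP _ _ k
  · exact altDepthAux_starH _ _ k

/-- The stars of a variable are small (well-formed labelling). [folklore] -/
theorem size_of_mem_stars (hΛ : Λ.WF N) {v : ℕ} {X : PropForm ℕ} (hX : X ∈ stars Λ N v) :
    X.size ≤ 2 * N + 3 := by
  simp only [stars, List.mem_append, List.mem_map, Option.mem_toList] at hX
  rcases hX with ⟨⟨b, J⟩, hq, rfl⟩ | ⟨⟨a, I⟩, hq, rfl⟩
  · exact (size_starP_le (hΛ.1 v b J hq).2).trans (by omega)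
  · exact size_starH_le (hΛ.2 v a I hq).2

/-- **`σ(v)` is small**: size `≤ 8N + 19`. [folklore] -/
theorem size_sigma_le (hΛ : Λ.WF N) (v : ℕ) : (sigma Λ N v).size ≤ 8 * N + 19 := by
  have := size_render_le (Λ.c v) (s := 2 * N + 3) (stars Λ N v) fun X hX => size_of_mem_stars hΛ hX
  unfold sigma; omega

/-- **`σ(v)` is shallow**: all auxiliary depths `≤ 4`. [folklore] -/
theorem altDepthAux_sigma_le (v k : ℕ) : altDepthAux k (sigma Λ N v) ≤ 4 :=
  altDepthAux_render_le (Λ.c v) (t := 1) (stars Λ N v) (fun _ hX j => altDepthAux_of_mem_stars hX j) k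

/-- The skeleton is small: size `≤ 11`. [folklore] -/
theorem size_skel_le (v : ℕ) : (skel Λ v).size ≤ 11 := by
  have := size_render_le (Λ.c v) (s := 1) (places Λ v) fun X hX => by
    simp only [places, List.mem_append, List.mem_map, Option.mem_toList] at hX
    rcases hX with ⟨_, -, rfl⟩ | ⟨_, -, rfl⟩ <;> simp [size]
  unfold skel; omega

/-- The skeleton is shallow: all auxiliary depths `≤ 3`. [folklore] -/
theorem altDepthAux_skel_le (v k : ℕ) : altDepthAux k (skel Λ v) ≤ 3 :=
  altDepthAux_render_le (Λ.c v) (t := 0) (places Λ v) (fun X hX j => by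
    simp only [places, List.mem_append, List.mem_map, Option.mem_toList] at hX
    rcases hX with ⟨_, -, rfl⟩ | ⟨_, -, rfl⟩ <;> simp [altDepthAux]) k

/-- Variables of the skeleton of `v` are its placeholders, and only of existing stars.
[folklore] -/
theorem mem_vars_skel {v x : ℕ} (hx : x ∈ (skel Λ v).vars) :
    (x = 2 * v ∧ (Λ.ps v).isSome) ∨ (x = 2 * v + 1 ∧ (Λ.hs v).isSome) := by
  obtain ⟨X, hX, hxX⟩ := mem_vars_render (L := places Λ v) (by simpa [skel] using hx)
  simp only [places, List.mem_append, List.mem_map, Option.mem_toList] at hX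
  rcases hX with ⟨q, hq, rfl⟩ | ⟨q, hq, rfl⟩
  · left; simp only [vars, Finset.mem_singleton] at hxX; exact ⟨hxX, by rw [hq]; rfl⟩
  · right; simp only [vars, Finset.mem_singleton] at hxX; exact ⟨hxX, by rw [hq]; rfl⟩

/-- **The skeleton instantiates to `σ`**: `skel(v)ρ = σ(v)`. [folklore] -/
theorem skel_subst_rho (v : ℕ) : (skel Λ v).subst (rho Λ N) = sigma Λ N v := by
  unfold skel sigma
  rw [render_subst]
  congr 1
  unfold places stars
  rw [List.map_append, List.map_map, List.map_map]
  congr 1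
  · cases hps : Λ.ps v with
    | none => rfl
    | some q => simp [Function.comp, PropForm.subst, rho, hps]
  · cases hhs : Λ.hs v with
    | none => rfl
    | some q => simp [Function.comp, PropForm.subst, rho, hhs]

/-- Sizes of the star substitution `ρ` (well-formed labelling). [folklore] -/
theorem size_rho_le (hΛ : Λ.WF N) (x : ℕ) : (rho Λ N x).size ≤ 2 * N + 3 := by
  unfold rho
  split_ifs with h
  · cases hq : Λ.ps (x / 2) with
    | none => simp [size]
    | some q =>
      obtain ⟨b, J⟩ := q
      exact (size_starP_le (hΛ.1 _ b J hq).2).trans (by omega)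
  · cases hq : Λ.hs (x / 2) with
    | none => simp [size]
    | some q =>
      obtain ⟨a, I⟩ := q
      exact size_starH_le (hΛ.2 _ a I hq).2

/-- Depths of the star substitution `ρ`. [folklore] -/
theorem altDepthAux_rho_le (x k : ℕ) : altDepthAux k (rho Λ N x) ≤ 1 := by
  unfold rho
  split_ifs with h
  · cases hq : Λ.ps (x / 2) with
    | none => simp [altDepthAux]
    | some q => exact altDepthAux_starP _ _ k
  · cases hq : Λ.hs (x / 2) with
    | none => simp [altDepthAux]
    | some q => exact altDepthAux_starH _ _ k

/-! ### Values -/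

/-- **The skeleton evaluates to the value** under the placeholder assignment of `(f, g)`.
[folklore] -/
theorem eval_skel_tau0 (f g : ℕ → ℕ) (v : ℕ) : (skel Λ v).eval (tau0 Λ f g) = val Λ f g v := by
  unfold skel val
  rw [eval_render _ _ _ (length_places_le v)]
  unfold places pval hval
  cases hps : Λ.ps v with
  | none =>
    cases hhs : Λ.hs v with
    | none => simp
    | some q => simp [eval, tau0, hval, hhs]
  | some q =>
    cases hhs : Λ.hs v with
    | none => simp [eval, tau0, pval, hps]
    | some q' => simp [eval, tau0, pval, hval, hps, hhs]

/-- The skeleton of `v` under any assignment agreeing with `τ₀` on the placeholders of `v`.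
[folklore] -/
theorem eval_skel_of_agree {f g : ℕ → ℕ} {τ : ℕ → Bool} {v : ℕ}
    (hP : (Λ.ps v).isSome → τ (2 * v) = tau0 Λ f g (2 * v))
    (hH : (Λ.hs v).isSome → τ (2 * v + 1) = tau0 Λ f g (2 * v + 1)) :
    (skel Λ v).eval τ = val Λ f g v := by
  rw [← eval_skel_tau0 f g v]
  refine eval_congr_vars fun x hx => ?_
  rcases mem_vars_skel hx with ⟨rfl, h⟩ | ⟨rfl, h⟩
  · exact hP h
  · exact hH h


/-! ### Deciding a star from one unit

The line budget of every star sequent is `starLines N = (N + 3) · extractLines N`; the size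
parameter must satisfy `B ≥ 1000 (N+1)^4`, the depth parameter `D ≥ 12`. -/

/-- Line budget for deciding one star. [folklore] -/
def starLines (N : ℕ) : ℕ :=
  (N + 3) * extractLines N

variable {D B : ℕ}

/-- **A disjunction of atoms containing the unit is true**: `⊢ ⋁Lst, ¬A` for `A ∈ Lst`.
[cite: KrajicekProofComplexity2019, §15.4 (proof of Lemma 15.4.3, Claim 1: evaluating σ under the assignment)] -/
theorem disjTrueS {Lst : List (PropForm ℕ)} {A : PropForm ℕ} (hat : ∀ w ∈ Lst, ∃ b a, w = pv N b a)
    (hA : A ∈ Lst) (hlen : Lst.length ≤ N + 1) (hD : 12 ≤ D) (hB : 1000 * (N + 1) ^ 4 ≤ B) :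
    BD D B (starLines N) (disjList [disjList Lst, neg A]) := by
  obtain ⟨b₀, a₀, rfl⟩ := hat A hA
  have hms : msum Lst = 2 * Lst.length := msum_atoms hat
  have hsz : (disjList Lst).size = 2 * Lst.length + 1 := size_disjList_atoms hat
  have hN4 : N + 1 ≤ (N + 1) ^ 4 := Nat.le_self_pow (by norm_num) _
  have hdd : ∀ X ∈ Lst, X.dd ≤ 0 := fun X hX => by obtain ⟨b, a, rfl⟩ := hat X hX; simp
  -- `⊢ ¬A, Lst`
  have h1 : BD D B (12 + 6 * Lst.length) (disjList (neg (pv N b₀ a₀) :: Lst)) := by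
    have := memberIntroB (D := D) (B := B) hA hdd (by omega) (by rw [hsz]; omega)
    rwa [← disjList_cons] at this
  -- `⊢ Lst, ¬A`
  have h2 : BD D B (12 + 6 * Lst.length + 50 * (N + 3 + 1) ^ 2) (disjList (Lst ++ [neg (pv N b₀ a₀)])) := by
    refine subsetN (N := N + 3) h1 (fun X hX => ?_) (p := 1) ?_ (by omega) ?_
      (by rw [List.length_cons]; omega) (by rw [List.length_append, List.length_singleton]; omega)
    · simp only [List.mem_cons, List.mem_append] at hX ⊢; tauto
    · intro X hX
      rcases List.mem_append.1 hX with hX | hX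
      · exact (hdd X hX).trans (by omega)
      · simp only [List.mem_singleton] at hX; subst hX; simp [pv]
    · simp only [size_disjList_eq_msum, msum_cons, msum_append, msum_nil, size, pv] at hms ⊢
      omega
  -- `⊢ ⋁Lst, ¬A`
  have h3 := nestAllS Lst (L := [neg (pv N b₀ a₀)]) h2 (p := 1) ?_ (by omega) (N := N + 7)
    (by simp; omega) ?_
  rotate_left
  · intro X hX
    rcases List.mem_append.1 hX with hX | hX
    · exact (hdd X hX).trans (by omega)
    · simp only [List.mem_singleton] at hX; subst hX; simp [pv]
  · simp only [msum_append, msum_cons, msum_nil, size, pv] at hms ⊢; omega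
  refine h3.mono ?_
  unfold starLines extractLines
  have e1 : (Lst.length + 1) * (100 * (N + 7 + 1) ^ 2 + 1) ≤ (N + 2) * (100 * (N + 8) ^ 2 + 1) :=
    Nat.mul_le_mul (by omega) le_rfl
  have e2 : (N + 8) ^ 2 ≤ 16 * (N + 2) ^ 2 := by nlinarith
  have e3 : (N + 3 + 1) ^ 2 ≤ 4 * (N + 2) ^ 2 := by nlinarith
  have e4 : (N + 2) ^ 2 ≤ (N + 2) ^ 4 := Nat.pow_le_pow_right (by omega) (by omega)
  have e5 : (N + 2) * (N + 2) ^ 2 ≤ (N + 2) ^ 4 := by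
    calc (N + 2) * (N + 2) ^ 2 = (N + 2) ^ 3 := by ring
      _ ≤ (N + 2) ^ 4 := Nat.pow_le_pow_right (by omega) (by omega)
  nlinarith [e1, e2, e3, e4, e5]

/-- **A disjunction of atoms all excluded by the unit is false**: from `⊢ ¬z, ¬u, ¬R` for every
`z ∈ Lst` infer `⊢ ¬⋁Lst, ¬u, ¬R`. [cite: KrajicekProofComplexity2019, §15.4 (proof of Lemma 15.4.3, Claim 1)] -/
theorem disjFalseS {Lst : List (PropForm ℕ)} {u : PropForm ℕ} (hat : ∀ w ∈ Lst, ∃ b a, w = pv N b a)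
    (hu : ∃ b a, u = pv N b a) (hlen : Lst.length ≤ N + 1)
    (hz : ∀ z ∈ Lst, BD D B (extractLines N + 800) (disjList [neg z, neg u, neg (ophp N)]))
    (hD : 12 ≤ D) (hB : 1000 * (N + 1) ^ 4 ≤ B) :
    BD D B (starLines N) (disjList [neg (disjList Lst), neg u, neg (ophp N)]) := by
  obtain ⟨b₀, a₀, rfl⟩ := hu
  have hR := size_ophp_le (N := N)
  have hsz : (disjList Lst).size = 2 * Lst.length + 1 := size_disjList_atoms hat
  have hN4 : N + 1 ≤ (N + 1) ^ 4 := Nat.le_self_pow (by norm_num) _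
  have hdd : ∀ X ∈ Lst, X.dd ≤ 4 := fun X hX => by obtain ⟨b, a, rfl⟩ := hat X hX; simp
  have h := negDisjListS Lst (L := [neg (pv N b₀ a₀), neg (ophp N)]) hz hdd (p := 4)
    (dd_disjList_le fun X hX => by
      simp only [List.mem_cons, List.not_mem_nil, or_false] at hX
      rcases hX with rfl | rfl
      · simp [pv]
      · exact dd_neg_ophp_le) (by omega)
    (by simp only [size_disjList_cons, size_disjList_nil, size, pv, hsz]; omega)
  refine h.mono ?_
  unfold starLines
  set X := extractLines N with hX
  have hM : N + 2 ≤ (N + 2) ^ 4 := Nat.le_self_pow (by norm_num) _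
  have e1 : Lst.length * (X + 800 + 35) ≤ (N + 1) * (X + 835) := Nat.mul_le_mul hlen (by omega)
  have e3 : 835 * (N + 1) + 4 ≤ 2 * X := by rw [hX]; unfold extractLines; nlinarith [hM]
  calc 4 + Lst.length * (X + 800 + 35) ≤ 4 + (N + 1) * (X + 835) := Nat.add_le_add_left e1 _
    _ = (N + 1) * X + (835 * (N + 1) + 4) := by ring
    _ ≤ (N + 1) * X + 2 * X := Nat.add_le_add_left e3 _
    _ = (N + 3) * X := by ring

/-- **A pigeon-star containing the hole of its pigeon is true**: `⊢ ⋁_{a∈J} p_{b,a}, ¬p_{b,a₀}` for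
`a₀ ∈ J`. [cite: KrajicekProofComplexity2019, §15.4 (proof of Lemma 15.4.3, Claim 1)] -/
theorem starPTrueS {b a₀ : ℕ} {J : Finset ℕ} (hJ : ∀ a ∈ J, a < N) (ha₀ : a₀ ∈ J) (hD : 12 ≤ D)
    (hB : 1000 * (N + 1) ^ 4 ≤ B) : BD D B (starLines N) (disjList [starP N b J, neg (pv N b a₀)]) := by
  refine disjTrueS (starP_atoms b J) (List.mem_map.2 ⟨a₀, mem_sort_iff.2 ha₀, rfl⟩) ?_ hD hB
  rw [List.length_map, Finset.length_sort]
  calc J.card ≤ (Finset.range N).card := Finset.card_le_card fun a ha => Finset.mem_range.2 (hJ a ha)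
    _ = N := Finset.card_range N
    _ ≤ N + 1 := by omega

/-- **A pigeon-star missing the hole of its pigeon is false**: `⊢ ¬⋁_{a∈J} p_{b,a}, ¬p_{b,a₀}, ¬R`
for `a₀ ∉ J` (functionality clauses). [cite: KrajicekProofComplexity2019, §15.4 (proof of Lemma 15.4.3, Claim 1)] -/
theorem starPFalseS {b a₀ : ℕ} {J : Finset ℕ} (hb : b < N + 1) (hJ : ∀ a ∈ J, a < N) (ha₀ : a₀ < N)
    (hnot : a₀ ∉ J) (hD : 12 ≤ D) (hB : 1000 * (N + 1) ^ 4 ≤ B) :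
    BD D B (starLines N) (disjList [neg (starP N b J), neg (pv N b a₀), neg (ophp N)]) := by
  refine disjFalseS (starP_atoms b J) ⟨b, a₀, rfl⟩ ?_ (fun z hz => ?_) hD hB
  · rw [List.length_map, Finset.length_sort]
    calc J.card ≤ (Finset.range N).card := Finset.card_le_card fun a ha => Finset.mem_range.2 (hJ a ha)
      _ = N := Finset.card_range N
      _ ≤ N + 1 := by omega
  · obtain ⟨a, ha, rfl⟩ := List.mem_map.1 hz
    rw [mem_sort_iff] at ha
    exact funcS hb (fun h => hnot (h ▸ ha)) (hJ a ha) ha₀ hD hB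

/-- **A hole-star containing the pigeon of its hole is true**: `⊢ ⋁_{b∈I} p_{b,a}, ¬p_{b₀,a}` for
`b₀ ∈ I`. [cite: KrajicekProofComplexity2019, §15.4 (proof of Lemma 15.4.3, Claim 1)] -/
theorem starHTrueS {a b₀ : ℕ} {I : Finset ℕ} (hI : ∀ b ∈ I, b < N + 1) (hb₀ : b₀ ∈ I) (hD : 12 ≤ D)
    (hB : 1000 * (N + 1) ^ 4 ≤ B) : BD D B (starLines N) (disjList [starH N a I, neg (pv N b₀ a)]) := by
  refine disjTrueS (starH_atoms a I) (List.mem_map.2 ⟨b₀, mem_sort_iff.2 hb₀, rfl⟩) ?_ hD hB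
  rw [List.length_map, Finset.length_sort]
  calc I.card ≤ (Finset.range (N + 1)).card :=
        Finset.card_le_card fun b hb => Finset.mem_range.2 (hI b hb)
    _ = N + 1 := Finset.card_range (N + 1)

/-- **A hole-star missing the pigeon of its hole is false**: `⊢ ¬⋁_{b∈I} p_{b,a}, ¬p_{b₀,a}, ¬R`
for `b₀ ∉ I` (hole clauses). [cite: KrajicekProofComplexity2019, §15.4 (proof of Lemma 15.4.3, Claim 2)] -/
theorem starHFalseS {a b₀ : ℕ} {I : Finset ℕ} (ha : a < N) (hI : ∀ b ∈ I, b < N + 1) (hb₀ : b₀ < N + 1)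
    (hnot : b₀ ∉ I) (hD : 12 ≤ D) (hB : 1000 * (N + 1) ^ 4 ≤ B) :
    BD D B (starLines N) (disjList [neg (starH N a I), neg (pv N b₀ a), neg (ophp N)]) := by
  refine disjFalseS (starH_atoms a I) ⟨b₀, a, rfl⟩ ?_ (fun z hz => ?_) hD hB
  · rw [List.length_map, Finset.length_sort]
    calc I.card ≤ (Finset.range (N + 1)).card :=
          Finset.card_le_card fun b hb => Finset.mem_range.2 (hI b hb)
      _ = N + 1 := Finset.card_range (N + 1)
  · obtain ⟨b, hb, rfl⟩ := List.mem_map.1 hz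
    rw [mem_sort_iff] at hb
    exact holeS (fun h => hnot (h ▸ hb)) (hI b hb) hb₀ ha hD hB


/-! ### Placeholders of a variable list and the skeleton sequent -/

section Skeleton

variable (Λ)

/-- The placeholder indices of the stars labelling a variable list. [folklore] -/
def placeIdx (V : List ℕ) : List ℕ :=
  V.flatMap fun v => ((Λ.ps v).toList.map fun _ => 2 * v) ++ ((Λ.hs v).toList.map fun _ => 2 * v + 1)

variable {Λ}

/-- Membership in the placeholder index list. [folklore] -/
theorem mem_placeIdx_iff {V : List ℕ} {q : ℕ} :
    q ∈ placeIdx Λ V ↔ ∃ v ∈ V, (q = 2 * v ∧ (Λ.ps v).isSome) ∨ (q = 2 * v + 1 ∧ (Λ.hs v).isSome) := by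
  simp only [placeIdx, List.mem_flatMap, List.mem_append, List.mem_map, Option.mem_toList]
  constructor
  · rintro ⟨v, hv, ⟨q', hq', rfl⟩ | ⟨q', hq', rfl⟩⟩
    · exact ⟨v, hv, Or.inl ⟨rfl, by rw [hq']; rfl⟩⟩
    · exact ⟨v, hv, Or.inr ⟨rfl, by rw [hq']; rfl⟩⟩
  · rintro ⟨v, hv, ⟨rfl, h⟩ | ⟨rfl, h⟩⟩
    · obtain ⟨q', hq'⟩ := Option.isSome_iff_exists.1 h
      exact ⟨v, hv, Or.inl ⟨q', hq', rfl⟩⟩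
    · obtain ⟨q', hq'⟩ := Option.isSome_iff_exists.1 h
      exact ⟨v, hv, Or.inr ⟨q', hq', rfl⟩⟩

/-- The placeholder index list has at most two entries per variable. [folklore] -/
theorem length_placeIdx_le (V : List ℕ) : (placeIdx Λ V).length ≤ 2 * V.length := by
  induction V with
  | nil => simp [placeIdx]
  | cons v V ih =>
    have h1 := length_places_le (Λ := Λ) v
    unfold placeIdx at ih ⊢
    rw [List.flatMap_cons, List.length_append, List.length_cons]
    have : (((Λ.ps v).toList.map fun _ => 2 * v) ++ ((Λ.hs v).toList.map fun _ => 2 * v + 1)).length ≤ 2 := by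
      rw [List.length_append, List.length_map, List.length_map]
      cases Λ.ps v <;> cases Λ.hs v <;> simp
    omega

/-- The placeholder index list of a duplicate-free variable list is duplicate-free. [folklore] -/
theorem nodup_placeIdx {V : List ℕ} (hV : V.Nodup) : (placeIdx Λ V).Nodup := by
  unfold placeIdx
  rw [List.nodup_flatMap]
  constructor
  · intro v _
    cases Λ.ps v <;> cases Λ.hs v <;> simp
  · refine hV.imp fun {v w} hvw => ?_
    intro q hq hq'
    simp only [List.mem_append, List.mem_map, Option.mem_toList] at hq hq'
    rcases hq with ⟨_, _, rfl⟩ | ⟨_, _, rfl⟩ <;> rcases hq' with ⟨_, _, h⟩ | ⟨_, _, h⟩ <;> omega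

/-- Variables of a rendered clause. [folklore] -/
theorem exists_of_mem_vars_clauseOf {C : Clause ℕ} {x : ℕ} (hx : x ∈ (clauseOf C).vars) :
    ∃ l ∈ C, l.1 = x := by
  induction C with
  | nil => simp [clauseOf, disjList, vars] at hx
  | cons l C ih =>
    simp only [clauseOf, List.map_cons, disjList_cons, vars, Finset.mem_union] at hx ih ⊢
    rcases hx with hx | hx
    · refine ⟨l, List.mem_cons_self, ?_⟩
      unfold litOf at hx
      split_ifs at hx <;> simp only [vars, Finset.mem_singleton] at hx <;> exact hx.symm
    · obtain ⟨l', hl', rfl⟩ := ih hx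
      exact ⟨l', List.mem_cons_of_mem _ hl', rfl⟩

/-- Size of a rendered clause. [folklore] -/
theorem size_clauseOf_le (C : Clause ℕ) : (clauseOf C).size ≤ 3 * C.length + 1 := by
  unfold clauseOf
  rw [size_disjList_eq_msum]
  have : msum (C.map litOf) ≤ (C.map litOf).length * 3 :=
    msum_le_length_mul fun X hX => by
      obtain ⟨l, -, rfl⟩ := List.mem_map.1 hX
      unfold litOf; split_ifs <;> simp [size]
  rw [List.length_map] at this
  omega

/-- **The skeleton sequent is tautological.** For a clause `C` over `V` that is true under
`val Λ f g`, the sequent `⊢ assump τ₀ Q, (clauseOf C)skel` (with `Q` the placeholders of `V`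
and `τ₀` the placeholder assignment of `(f, g)`) has a true member under every assignment: an
assignment either differs from `τ₀` on a placeholder, or makes the skeleton clause evaluate like
`C` under `val Λ f g`. [cite: KrajicekProofComplexity2019, §15.4 (proof of Lemma 15.4.3: σ(Cli(A)) is decided by the assignment)] -/
theorem skeleton_taut {V : List ℕ} {C : Clause ℕ} (hC : ∀ l ∈ C, l.1 ∈ V) {f g : ℕ → ℕ}
    (hsem : (clauseOf C).eval (val Λ f g) = true) (τ : ℕ → Bool) :
    ∃ A ∈ assump (tau0 Λ f g) (placeIdx Λ V) ++ [(clauseOf C).subst (skel Λ)], A.eval τ = true := by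
  classical
  by_cases hag : ∀ q ∈ placeIdx Λ V, τ q = tau0 Λ f g q
  · refine ⟨(clauseOf C).subst (skel Λ), List.mem_append_right _ (List.mem_singleton_self _), ?_⟩
    rw [eval_subst, ← hsem]
    refine eval_congr_vars fun x hx => ?_
    obtain ⟨l, hl, rfl⟩ := exists_of_mem_vars_clauseOf hx
    have hlV := hC l hl
    exact eval_skel_of_agree (fun h => hag _ (mem_placeIdx_iff.2 ⟨l.1, hlV, Or.inl ⟨rfl, h⟩⟩))
      (fun h => hag _ (mem_placeIdx_iff.2 ⟨l.1, hlV, Or.inr ⟨rfl, h⟩⟩))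
  · push Not at hag
    obtain ⟨q, hq, hne⟩ := hag
    cases h0 : tau0 Λ f g q with
    | true =>
      refine ⟨neg (var q), List.mem_append_left _ (neg_var_mem_assump hq h0), ?_⟩
      have : τ q = false := by simpa [h0] using hne
      simp [eval, this]
    | false =>
      refine ⟨var q, List.mem_append_left _ (var_mem_assump hq h0), ?_⟩
      have : τ q = true := by simpa [h0] using hne
      simp [eval, this]

/-- **The skeleton sequent, derived** (constant size: `TextbookFrege.tautSeqS` over the `≤ 2|V|`
placeholders), at disjunct depth `13` and line size `1700 (|V| + 1)`. [cite: KrajicekProofComplexity2019, §15.4 (proof of Lemma 15.4.3)] -/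
theorem skeletonS {V : List ℕ} (hV : V.Nodup) {C : Clause ℕ} (hC : ∀ l ∈ C, l.1 ∈ V)
    (hClen : C.length ≤ V.length) {f g : ℕ → ℕ} (hsem : (clauseOf C).eval (val Λ f g) = true) :
    BD 13 (1700 * (V.length + 2)) (tautLines (2 * V.length + 1) (40 * (V.length + 1)))
      (disjList (assump (tau0 Λ f g) (placeIdx Λ V) ++ [(clauseOf C).subst (skel Λ)])) := by
  set Q := placeIdx Λ V with hQ
  have hQlen : Q.length ≤ 2 * V.length := length_placeIdx_le V
  have hszC : (clauseOf C).size ≤ 3 * V.length + 1 := (size_clauseOf_le C).trans (by omega)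
  have hszD : ((clauseOf C).subst (skel Λ)).size ≤ (3 * V.length + 1) * 11 :=
    (size_subst_le (fun v => size_skel_le (Λ := Λ) v) (by norm_num) _).trans (Nat.mul_le_mul_right _ hszC)
  refine tautSeqS _ Q (nodup_placeIdx hV) (N := 2 * V.length + 1) (q := 5) (by omega) ?_ ?_
    (skeleton_taut hC hsem) ?_ ?_ (by norm_num) ?_
  · rw [List.length_append, length_assump, List.length_singleton]; omega
  · intro A hA x hx
    rcases List.mem_append.1 hA with hA | hA
    · obtain ⟨q, hq, rfl⟩ := List.mem_map.1 hA
      split_ifs at hx <;> simp only [vars, Finset.mem_singleton] at hx <;> exact hx ▸ hq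
    · rw [List.mem_singleton] at hA
      subst hA
      obtain ⟨y, hy, hxy⟩ := mem_vars_subst hx
      obtain ⟨l, hl, rfl⟩ := exists_of_mem_vars_clauseOf hy
      rcases mem_vars_skel hxy with ⟨rfl, h⟩ | ⟨rfl, h⟩
      · exact mem_placeIdx_iff.2 ⟨l.1, hC l hl, Or.inl ⟨rfl, h⟩⟩
      · exact mem_placeIdx_iff.2 ⟨l.1, hC l hl, Or.inr ⟨rfl, h⟩⟩
  · intro A hA
    rcases List.mem_append.1 hA with hA | hA
    · exact ((dd_le_of_mem_assump hA).trans (by norm_num) : A.dd ≤ 5) |> fun _ => by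
        obtain ⟨q, -, rfl⟩ := List.mem_map.1 hA
        split_ifs <;> simp [altDepth, altDepthAux]
    · rw [List.mem_singleton] at hA
      subst hA
      have h1 := altDepthAux_subst_le (σ := skel Λ) (T := 3) (fun v c => altDepthAux_skel_le v c) (clauseOf C) 0
      have h2 : altDepthAux 0 (clauseOf C) ≤ 2 := altDepth_clauseOf_le C
      show altDepthAux 0 _ ≤ 5
      omega
  · rw [msum_append, msum_cons, msum_nil]
    have := msum_assump_le (tau0 Λ f g) Q
    omega
  · omega

end Skeleton

/-! ### A consistent case: the clause from the decided stars -/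

/-- Line budget of a consistent case over a variable list of length `Vl` with `T` case units.
[folklore] -/
def caseLines (N Vl T : ℕ) : ℕ :=
  tautLines (2 * Vl + 1) (40 * (Vl + 1)) + 50 * (T + 2 * Vl + 9) ^ 2 +
    2 * Vl * (starLines N + 50 * (T + 2 * Vl + 9) ^ 2 + 10)

/-- **A consistent case.** Let `W` be a list of atoms containing, for every pigeon-star `(b, J)`
labelling `V`, the unit `p_{b, f b}`, and for every hole-star `(a, I)` the unit `p_{g a, a}`, with
`(f, g)` consistent on `V`. If the clause `C` over `V` is true under `val Λ f g`, then
`⊢ ¬W, ¬R, (clauseOf C)σ`: instantiate the skeleton sequent by the stars (`BD.subst`) and cut the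
decided stars away (`starPTrueS`, …). [cite: KrajicekProofComplexity2019, §15.4 (proof of Lemma 15.4.3, Claims 1–2)] -/
theorem consistentCaseS (hΛ : Λ.WF N) {V : List ℕ} (hV : V.Nodup) {C : Clause ℕ}
    (hC : ∀ l ∈ C, l.1 ∈ V) (hClen : C.length ≤ V.length) {f g : ℕ → ℕ}
    (hcons : ConsistentL Λ N V f g) (hsem : (clauseOf C).eval (val Λ f g) = true)
    {W : List (PropForm ℕ)} {T : ℕ} (hW : ∀ w ∈ W, ∃ b a, w = pv N b a) (hWlen : W.length ≤ T)
    (hWp : ∀ v ∈ V, ∀ b J, Λ.ps v = some (b, J) → pv N b (f b) ∈ W)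
    (hWh : ∀ v ∈ V, ∀ a I, Λ.hs v = some (a, I) → pv N (g a) a ∈ W)
    (hD : 14 ≤ D) (hB : 1000 * (N + 1) ^ 4 + 4000 * (V.length + T + 2) * (N + 3) ≤ B) :
    BD D B (caseLines N V.length T)
      (disjList ((W.map neg) ++ [neg (ophp N), (clauseOf C).subst (sigma Λ N)])) := by
  set Q := placeIdx Λ V with hQ
  set τ₀ := tau0 Λ f g with hτ₀
  set Dj := (clauseOf C).subst (sigma Λ N) with hDj
  set L := (W.map neg) ++ [neg (ophp N), Dj] with hL
  set Xs := (assump τ₀ Q).map (PropForm.subst (rho Λ N)) with hXs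
  obtain ⟨hc1, hc2, -, -, -⟩ := hcons
  have hR := size_ophp_le (N := N)
  have hN4 : N + 1 ≤ (N + 1) ^ 4 := Nat.le_self_pow (by norm_num) _
  have hctx : 12 * (2 * V.length * (2 * N + 5)) + 8 * ((3 * V.length + 1) * (8 * N + 19)) + 24 * T +
      12 * N + 400 ≤ 4000 * (V.length + T + 2) * (N + 3) := by
    have := Nat.zero_le (V.length * N); have := Nat.zero_le (T * N); nlinarith
  have hskB : 1700 * (V.length + 2) * (2 * N + 3) ≤ B := by
    have e : 1700 * (V.length + 2) * (2 * N + 3) ≤ 4000 * (V.length + T + 2) * (N + 3) := by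
      have := Nat.zero_le (V.length * N); have := Nat.zero_le (T * N); nlinarith
    exact e.trans ((Nat.le_add_left _ _).trans hB)
  have hQlen : Q.length ≤ 2 * V.length := length_placeIdx_le V
  have hXlen : Xs.length ≤ 2 * V.length := by rw [hXs, List.length_map, length_assump]; exact hQlen
  -- sizes
  have hszC : (clauseOf C).size ≤ 3 * V.length + 1 := (size_clauseOf_le C).trans (by omega)
  have hszDj : Dj.size ≤ (3 * V.length + 1) * (8 * N + 19) :=
    (size_subst_le (fun v => size_sigma_le hΛ v) (by omega) _).trans (Nat.mul_le_mul_right _ hszC)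
  have hmsW : msum (W.map neg) = 3 * W.length := msum_map_neg_atoms hW
  have hmsL : msum L ≤ 3 * T + 32 * (N + 1) ^ 4 + 3 + (3 * V.length + 1) * (8 * N + 19) + 1 := by
    rw [hL, msum_append, msum_cons, msum_cons, msum_nil, hmsW]
    simp only [size]; omega
  have hmsXs : msum Xs ≤ 2 * V.length * (2 * N + 5) := by
    have h1 : msum Xs ≤ Xs.length * (2 * N + 5) := msum_le_length_mul fun X hX => by
      obtain ⟨A, hA, rfl⟩ := List.mem_map.1 hX
      obtain ⟨q, -, rfl⟩ := List.mem_map.1 hA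
      have := size_rho_le hΛ q
      split_ifs <;> simp only [PropForm.subst, size] <;> omega
    exact h1.trans (Nat.mul_le_mul_right _ hXlen)
  -- depths
  have hddXs : ∀ X ∈ Xs, X.dd ≤ 2 ∧ (neg X).dd ≤ 4 := by
    intro X hX
    obtain ⟨A, hA, rfl⟩ := List.mem_map.1 hX
    obtain ⟨q, -, rfl⟩ := List.mem_map.1 hA
    have h3 := altDepthAux_rho_le (Λ := Λ) (N := N) q 3
    have h1 := altDepthAux_rho_le (Λ := Λ) (N := N) q 1
    split_ifs <;> simp only [PropForm.subst, dd_neg, altDepthAux_one_neg] <;> constructor <;>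
      (try unfold dd) <;> omega
  have hddDj : Dj.dd ≤ 6 := by
    rw [hDj]
    have h1 := altDepthAux_subst_le (σ := sigma Λ N) (T := 4) (fun v c => altDepthAux_sigma_le v c) (clauseOf C) 3
    have h2 : altDepthAux 3 (clauseOf C) ≤ 2 := (altDepthAux_le_altDepth' 3 _).trans (altDepth_clauseOf_le C)
    unfold dd; omega
  have hddL : ∀ X ∈ L, X.dd ≤ 6 := by
    intro X hX
    rw [hL] at hX
    simp only [List.mem_append, List.mem_map, List.mem_cons, List.not_mem_nil, or_false] at hX
    rcases hX with ⟨w, hw, rfl⟩ | rfl | rfl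
    · obtain ⟨b, a, rfl⟩ := hW w hw; simp [pv]
    · exact dd_neg_ophp_le.trans (by omega)
    · exact hddDj
  -- Step 1: the skeleton, instantiated: `⊢ Xs, Dj`
  have h1 : BD D B (tautLines (2 * V.length + 1) (40 * (V.length + 1))) (disjList (Xs ++ [Dj])) := by
    have h0 := skeletonS (Λ := Λ) hV hC hClen hsem
    have h0' := BD.subst (σ := rho Λ N) (T := 1) (Z := 2 * N + 3) (fun x c => altDepthAux_rho_le x c)
      (fun x => size_rho_le hΛ x) (by omega) h0
    rw [subst_disjList, List.map_append, List.map_cons, List.map_nil, PropForm.subst_subst] at h0'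
    have e : (fun x => (skel Λ x).subst (rho Λ N)) = sigma Λ N := funext fun v => skel_subst_rho v
    rw [e] at h0'
    exact h0'.weaken (by omega) hskB
  -- Step 2: weaken to the final context: `⊢ Xs, L`
  have h2 : BD D B (tautLines (2 * V.length + 1) (40 * (V.length + 1)) + 50 * (T + 2 * V.length + 8 + 1) ^ 2)
      (disjList (Xs ++ L)) := by
    refine subsetN (N := T + 2 * V.length + 8) h1 (fun A hA => ?_) (p := 6) ?_ (by omega) ?_ ?_ ?_
    · rcases List.mem_append.1 hA with hA | hA
      · exact List.mem_append_left _ hA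
      · rw [List.mem_singleton] at hA; subst hA; rw [hL]; simp
    · intro X hX
      rcases List.mem_append.1 hX with hX | hX
      · exact (hddXs X hX).1.trans (by omega)
      · exact hddL X hX
    · rw [size_disjList_eq_msum, size_disjList_eq_msum, msum_append, msum_append, msum_cons, msum_nil]
      omega
    · rw [List.length_append, List.length_singleton]; omega
    · rw [List.length_append, hL, List.length_append, List.length_map]; simp; omega
  -- Step 3: cut the decided stars away
  have h3 := elimAllS Xs h2 (L := L) (m := starLines N + 50 * (T + 2 * V.length + 8 + 1) ^ 2 + 6) ?_ ?_
  rotate_left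
  · intro X hX K hK
    have hKlen : K.length ≤ 2 * V.length := hK.length_le.trans hXlen
    have hKsub : ∀ Y ∈ K, Y ∈ Xs := fun Y hY => hK.subset hY
    have hmsK : msum K ≤ 2 * V.length * (2 * N + 5) := (msum_le_of_sublist hK.sublist).trans hmsXs
    obtain ⟨A, hA, rfl⟩ := List.mem_map.1 hX
    obtain ⟨q, hq, rfl⟩ := List.mem_map.1 hA
    have hLmem_unit : ∀ w ∈ W, neg w ∈ L := fun w hw => by
      rw [hL]; exact List.mem_append_left _ (List.mem_map.2 ⟨w, hw, rfl⟩)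
    have hLmem_R : neg (ophp N) ∈ L := by rw [hL]; simp
    -- the common weakening step: from a star sequent `⊢ S, rest` with `rest ⊆ L` to `⊢ S :: (K ++ L)`
    have weak : ∀ (S : PropForm ℕ) (rest : List (PropForm ℕ)), S.dd ≤ 4 → S.size ≤ 2 * N + 4 →
        (∀ Y ∈ rest, Y ∈ L) → rest.length ≤ 2 → BD D B (starLines N) (disjList (S :: rest)) →
        BD D B (starLines N + 50 * (T + 2 * V.length + 8 + 1) ^ 2) (disjList (S :: (K ++ L))) := by
      intro S rest hSdd hSsz hrest hrl hS
      have hmsrest : msum rest ≤ msum L + msum L := by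
        have : ∀ Y ∈ rest, Y.size + 1 ≤ msum L := fun Y hY => size_lt_msum (hrest Y hY)
        have h' := msum_le_length_mul this
        have : rest.length * msum L ≤ 2 * msum L := Nat.mul_le_mul_right _ hrl
        omega
      refine subsetN (N := T + 2 * V.length + 8) hS (fun Y hY => ?_) (p := 6) ?_ (by omega) ?_
        (by rw [List.length_cons]; omega) ?_
      · rcases List.mem_cons.1 hY with rfl | hY
        · exact List.mem_cons_self
        · exact List.mem_cons_of_mem _ (List.mem_append_right _ (hrest Y hY))
      · intro Y hY
        rcases List.mem_cons.1 hY with rfl | hY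
        · exact hSdd.trans (by omega)
        · rcases List.mem_append.1 hY with hY | hY
          · exact (hddXs Y (hKsub Y hY)).1.trans (by omega)
          · exact hddL Y hY
      · rw [size_disjList_eq_msum, size_disjList_eq_msum, msum_cons, msum_cons, msum_append]
        omega
      · rw [List.length_cons, List.length_append, hL, List.length_append, List.length_map]
        simp; omega
    have hctxdd : (neg (disjList (K ++ L))).dd ≤ 8 :=
      dd_neg_disjList_le (p := 6) fun Y hY => by
        rcases List.mem_append.1 hY with hY | hY
        · exact (hddXs Y (hKsub Y hY)).1.trans (by omega)
        · exact hddL Y hY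
    rcases mem_placeIdx_iff.1 hq with ⟨v, hv, ⟨rfl, hsome⟩ | ⟨rfl, hsome⟩⟩
    · -- pigeon-star of `v`
      obtain ⟨⟨b, J⟩, hps⟩ := Option.isSome_iff_exists.1 hsome
      obtain ⟨hb, hJ⟩ := hΛ.1 v b J hps
      have hρ : rho Λ N (2 * v) = starP N b J := by simp [rho, hps]
      have hτ : τ₀ (2 * v) = decide (f b ∈ J) := by simp [hτ₀, tau0, pval, hps]
      have hunit : neg (pv N b (f b)) ∈ L := hLmem_unit _ (hWp v hv b J hps)
      by_cases hfb : f b ∈ J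
      · -- star true: member `¬star`, cut needs `⊢ ¬¬star, …`
        have hm : τ₀ (2 * v) = true := by rw [hτ]; exact decide_eq_true hfb
        simp only [hm, if_true, PropForm.subst, hρ]
        have hS := starPTrueS (N := N) (D := D) (B := B) (b := b) hJ hfb (by omega) (by omega)
        have hw := weak (starP N b J) [neg (pv N b (f b))] (by
            have := altDepthAux_starP (N := N) b J 3; unfold dd; omega)
          ((size_starP_le hJ).trans (by omega)) (by simpa using hunit) (by simp) hS
        refine (consNegNegS hw ?_ (hctxdd.trans (by omega)) ?_).mono (by omega)
        · have := altDepthAux_starP (N := N) b J 1; rw [dd_neg]; omega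
        · rw [size_disjList_eq_msum, msum_cons, msum_append]
          have := size_starP_le (N := N) (b := b) hJ
          omega
      · -- star false: member `star`, cut needs `⊢ ¬star, …`
        have hm : τ₀ (2 * v) = false := by rw [hτ]; exact decide_eq_false hfb
        simp only [hm, Bool.false_eq_true, if_false, PropForm.subst, hρ]
        have hS := starPFalseS (N := N) (D := D) (B := B) hb hJ (hc1 v hv b J hps) hfb (by omega) (by omega)
        exact (weak (neg (starP N b J)) [neg (pv N b (f b)), neg (ophp N)] (by
            have := altDepthAux_starP (N := N) b J 1; rw [dd_neg]; omega)
          (by have := size_starP_le (N := N) (b := b) hJ; simp only [size]; omega)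
          (by intro Y hY; simp only [List.mem_cons, List.not_mem_nil, or_false] at hY
              rcases hY with rfl | rfl
              · exact hunit
              · exact hLmem_R) (by simp) hS).mono (by omega)
    · -- hole-star of `v`
      obtain ⟨⟨a, I⟩, hhs⟩ := Option.isSome_iff_exists.1 hsome
      obtain ⟨ha, hI⟩ := hΛ.2 v a I hhs
      have hρ : rho Λ N (2 * v + 1) = starH N a I := by simp [rho, hhs]
      have hτ : τ₀ (2 * v + 1) = decide (g a ∈ I) := by simp [hτ₀, tau0, hval, hhs]
      have hunit : neg (pv N (g a) a) ∈ L := hLmem_unit _ (hWh v hv a I hhs)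
      by_cases hga : g a ∈ I
      · have hm : τ₀ (2 * v + 1) = true := by rw [hτ]; exact decide_eq_true hga
        simp only [hm, if_true, PropForm.subst, hρ]
        have hS := starHTrueS (N := N) (D := D) (B := B) (a := a) hI hga (by omega) (by omega)
        have hw := weak (starH N a I) [neg (pv N (g a) a)] (by
            have := altDepthAux_starH (N := N) a I 3; unfold dd; omega)
          ((size_starH_le hI).trans (by omega)) (by simpa using hunit) (by simp) hS
        refine (consNegNegS hw ?_ (hctxdd.trans (by omega)) ?_).mono (by omega)
        · have := altDepthAux_starH (N := N) a I 1; rw [dd_neg]; omega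
        · rw [size_disjList_eq_msum, msum_cons, msum_append]
          have := size_starH_le (N := N) (a := a) hI
          omega
      · have hm : τ₀ (2 * v + 1) = false := by rw [hτ]; exact decide_eq_false hga
        simp only [hm, Bool.false_eq_true, if_false, PropForm.subst, hρ]
        have hS := starHFalseS (N := N) (D := D) (B := B) ha hI (hc2 v hv a I hhs) hga (by omega) (by omega)
        exact (weak (neg (starH N a I)) [neg (pv N (g a) a), neg (ophp N)] (by
            have := altDepthAux_starH (N := N) a I 1; rw [dd_neg]; omega)
          (by have := size_starH_le (N := N) (a := a) hI; simp only [size]; omega)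
          (by intro Y hY; simp only [List.mem_cons, List.not_mem_nil, or_false] at hY
              rcases hY with rfl | rfl
              · exact hunit
              · exact hLmem_R) (by simp) hS).mono (by omega)
  · rw [size_disjList_eq_msum, msum_append]
    omega
  refine h3.mono ?_
  unfold caseLines
  have : Xs.length * (starLines N + 50 * (T + 2 * V.length + 8 + 1) ^ 2 + 6 + 2) ≤
      2 * V.length * (starLines N + 50 * (T + 2 * V.length + 9) ^ 2 + 10) :=
    Nat.mul_le_mul hXlen (by ring_nf; omega)
  have e : T + 2 * V.length + 8 + 1 = T + 2 * V.length + 9 := by omega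
  rw [e] at this ⊢
  omega


/-! ### The pigeons and holes labelling a variable list; the local maps of a case -/

section CaseMaps

variable (Λ)

/-- The pigeons of the pigeon-stars labelling `V` (without repetition). [folklore] -/
def pigeonsOf (V : List ℕ) : List ℕ :=
  (V.filterMap fun v => (Λ.ps v).map Prod.fst).dedup

/-- The holes of the hole-stars labelling `V` (without repetition). [folklore] -/
def holesOf (V : List ℕ) : List ℕ :=
  (V.filterMap fun v => (Λ.hs v).map Prod.fst).dedup

variable {Λ}

/-- The function of an association list (first match; default `0`). [folklore] -/
def assocFn : List (ℕ × ℕ) → ℕ → ℕ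
  | [], _ => 0
  | (k, x) :: l, b => if b = k then x else assocFn l b

/-- Membership in `pigeonsOf`. [folklore] -/
theorem mem_pigeonsOf_iff {V : List ℕ} {b : ℕ} :
    b ∈ pigeonsOf Λ V ↔ ∃ v ∈ V, ∃ J, Λ.ps v = some (b, J) := by
  simp only [pigeonsOf, List.mem_dedup, List.mem_filterMap, Option.map_eq_some_iff]
  constructor
  · rintro ⟨v, hv, ⟨b', J⟩, hq, rfl⟩; exact ⟨v, hv, J, hq⟩
  · rintro ⟨v, hv, J, hq⟩; exact ⟨v, hv, (b, J), hq, rfl⟩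

/-- Membership in `holesOf`. [folklore] -/
theorem mem_holesOf_iff {V : List ℕ} {a : ℕ} :
    a ∈ holesOf Λ V ↔ ∃ v ∈ V, ∃ I, Λ.hs v = some (a, I) := by
  simp only [holesOf, List.mem_dedup, List.mem_filterMap, Option.map_eq_some_iff]
  constructor
  · rintro ⟨v, hv, ⟨a', I⟩, hq, rfl⟩; exact ⟨v, hv, I, hq⟩
  · rintro ⟨v, hv, I, hq⟩; exact ⟨v, hv, (a, I), hq, rfl⟩

/-- At most one pigeon per variable. [folklore] -/
theorem length_pigeonsOf_le (V : List ℕ) : (pigeonsOf Λ V).length ≤ V.length :=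
  ((List.dedup_sublist _).length_le).trans (List.length_filterMap_le _ _)

/-- At most one hole per variable. [folklore] -/
theorem length_holesOf_le (V : List ℕ) : (holesOf Λ V).length ≤ V.length :=
  ((List.dedup_sublist _).length_le).trans (List.length_filterMap_le _ _)

/-- **The unit chosen for a key is among the case units** (generic in the unit former `F`).
[folklore] -/
theorem unit_mem_zipWith (F : ℕ → ℕ → PropForm ℕ) {k : ℕ} :
    ∀ {K xs : List ℕ}, xs.length = K.length → k ∈ K →
      F k (assocFn (K.zip xs) k) ∈ List.zipWith F K xs ∧ assocFn (K.zip xs) k ∈ xs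
  | [], _, _, hk => absurd hk List.not_mem_nil
  | k₀ :: K, [], h, _ => by simp at h
  | k₀ :: K, x :: xs, h, hk => by
    rw [List.zip_cons_cons, List.zipWith_cons_cons]
    by_cases hkk : k = k₀
    · subst hkk
      simp [assocFn]
    · have hk' : k ∈ K := (List.mem_cons.1 hk).resolve_left hkk
      have ih := unit_mem_zipWith F (K := K) (xs := xs) (by simpa using h) hk'
      simp only [assocFn, hkk, if_false]
      exact ⟨List.mem_cons_of_mem _ ih.1, List.mem_cons_of_mem _ ih.2⟩

end CaseMaps

/-! ### A case: consistent or refuted -/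

/-- Line budget of one case. [folklore] -/
def caseBudget (N Vl T : ℕ) : ℕ :=
  caseLines N Vl T + extractLines N + 1000 + 50 * (T + 2 * Vl + 9) ^ 2

/-- **An inconsistent case is refuted by one clause**: from `⊢ ¬u₁, ¬u₂, ¬R` with `u₁, u₂` among
the case units `W` to `⊢ ¬W, ¬R, Dj`. [cite: KrajicekProofComplexity2019, §15.4 (proof of Lemma 15.4.3, Claim 2: a non-injective assignment violates PHP)] -/
theorem refuteCaseS {W : List (PropForm ℕ)} {T : ℕ} (hW : ∀ w ∈ W, ∃ b a, w = pv N b a)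
    (hWlen : W.length ≤ T) {u₁ u₂ Dj : PropForm ℕ} (hu₁ : u₁ ∈ W) (hu₂ : u₂ ∈ W)
    (hDjdd : Dj.dd ≤ 6) {Z Vl : ℕ} (hDjsz : Dj.size ≤ Z)
    (h : BD D B (extractLines N + 800) (disjList [neg u₁, neg u₂, neg (ophp N)]))
    (hD : 14 ≤ D) (hB : 1000 * (N + 1) ^ 4 + 4 * Z + 12 * T + 100 ≤ B) :
    BD D B (caseBudget N Vl T) (disjList ((W.map neg) ++ [neg (ophp N), Dj])) := by
  have hR := size_ophp_le (N := N)
  have hN4 : N + 1 ≤ (N + 1) ^ 4 := Nat.le_self_pow (by norm_num) _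
  obtain ⟨b₁, a₁, rfl⟩ := hW u₁ hu₁
  obtain ⟨b₂, a₂, rfl⟩ := hW u₂ hu₂
  have hmsW : msum (W.map neg) = 3 * W.length := msum_map_neg_atoms hW
  refine (subsetN (N := T + 3) h (fun Y hY => ?_) (p := 6) ?_ (by omega) ?_ (by simp) ?_).mono ?_
  · simp only [List.mem_cons, List.not_mem_nil, or_false] at hY
    rcases hY with rfl | rfl | rfl
    · exact List.mem_append_left _ (List.mem_map.2 ⟨_, hu₁, rfl⟩)
    · exact List.mem_append_left _ (List.mem_map.2 ⟨_, hu₂, rfl⟩)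
    · simp
  · intro Y hY
    simp only [List.mem_append, List.mem_map, List.mem_cons, List.not_mem_nil, or_false] at hY
    rcases hY with ⟨w, hw, rfl⟩ | rfl | rfl
    · obtain ⟨b, a, rfl⟩ := hW w hw; simp [pv]
    · exact dd_neg_ophp_le.trans (by omega)
    · exact hDjdd
  · rw [size_disjList_eq_msum, size_disjList_eq_msum, msum_append, hmsW]
    simp only [msum_cons, msum_nil, size, pv]; omega
  · rw [List.length_append, List.length_map]; simp; omega
  · unfold caseBudget
    have : T + 3 + 1 ≤ T + 2 * Vl + 9 := by omega
    have := Nat.pow_le_pow_left this 2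
    omega

/-- **One case of the distribution.** For a choice `fl` of holes for the pigeons of `V` and `gl`
of pigeons for the holes of `V` (case units `W`), `⊢ ¬W, ¬R, (clauseOf C)σ`: the local maps
`(f, g)` read off the case are either consistent on `V` — then `consistentCaseS` applies, the
clause being true under `val Λ f g` by hypothesis — or violate injectivity / inverseness at two
units of `W`, which one hole or functionality clause of `ontoPHP` refutes.
[cite: KrajicekProofComplexity2019, §15.4 (proof of Lemma 15.4.3, Claims 1–2)] -/
theorem caseS (hΛ : Λ.WF N) {V : List ℕ} (hV : V.Nodup) {C : Clause ℕ}
    (hC : ∀ l ∈ C, l.1 ∈ V) (hClen : C.length ≤ V.length)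
    (hsem : ∀ f g : ℕ → ℕ, ConsistentL Λ N V f g → (clauseOf C).eval (val Λ f g) = true)
    {gl fl : List ℕ} (hgl : gl.length = (holesOf Λ V).length) (hfl : fl.length = (pigeonsOf Λ V).length)
    (hgN : ∀ b ∈ gl, b < N + 1) (hfN : ∀ a ∈ fl, a < N) {T : ℕ}
    (hT : (holesOf Λ V).length + (pigeonsOf Λ V).length ≤ T)
    (hD : 14 ≤ D) (hB : 1000 * (N + 1) ^ 4 + 4000 * (V.length + T + 2) * (N + 3) ≤ B) :
    BD D B (caseBudget N V.length T)
      (disjList (((caseUnits N (pigeonsOf Λ V) (holesOf Λ V) gl fl).map neg) ++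
        [neg (ophp N), (clauseOf C).subst (sigma Λ N)])) := by
  classical
  set Bl := pigeonsOf Λ V with hBl
  set Al := holesOf Λ V with hAl
  set W := caseUnits N Bl Al gl fl with hWdef
  set f := assocFn (Bl.zip fl) with hf
  set g := assocFn (Al.zip gl) with hg
  have hW : ∀ w ∈ W, ∃ b a, w = pv N b a := fun w hw => caseUnits_atom hw
  have hWlen : W.length ≤ T := (length_caseUnits_le (N := N) Bl Al gl fl).trans hT
  -- the units of the case and the ranges of the local maps
  have hfW : ∀ b ∈ Bl, pv N b (f b) ∈ W ∧ f b < N := fun b hb => by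
    have h := unit_mem_zipWith (fun b a => pv N b a) hfl hb
    exact ⟨List.mem_append_right _ h.1, hfN _ h.2⟩
  have hgW : ∀ a ∈ Al, pv N (g a) a ∈ W ∧ g a < N + 1 := fun a ha => by
    have h := unit_mem_zipWith (fun a b => pv N b a) hgl ha
    exact ⟨List.mem_append_left _ h.1, hgN _ h.2⟩
  have hpsB : ∀ v ∈ V, ∀ b J, Λ.ps v = some (b, J) → b ∈ Bl := fun v hv b J h =>
    mem_pigeonsOf_iff.2 ⟨v, hv, J, h⟩
  have hhsA : ∀ v ∈ V, ∀ a I, Λ.hs v = some (a, I) → a ∈ Al := fun v hv a I h =>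
    mem_holesOf_iff.2 ⟨v, hv, I, h⟩
  -- size/depth of the substituted clause (for the refutation branch)
  have hszC : (clauseOf C).size ≤ 3 * V.length + 1 := (size_clauseOf_le C).trans (by omega)
  have hszDj : ((clauseOf C).subst (sigma Λ N)).size ≤ (3 * V.length + 1) * (8 * N + 19) :=
    (size_subst_le (fun v => size_sigma_le hΛ v) (by omega) _).trans (Nat.mul_le_mul_right _ hszC)
  have hddDj : ((clauseOf C).subst (sigma Λ N)).dd ≤ 6 := by
    have h1 := altDepthAux_subst_le (σ := sigma Λ N) (T := 4) (fun v c => altDepthAux_sigma_le v c) (clauseOf C) 3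
    have h2 : altDepthAux 3 (clauseOf C) ≤ 2 := (altDepthAux_le_altDepth' 3 _).trans (altDepth_clauseOf_le C)
    unfold dd; omega
  have hBref : 1000 * (N + 1) ^ 4 + 4 * ((3 * V.length + 1) * (8 * N + 19)) + 12 * T + 100 ≤ B := by
    have : 4 * ((3 * V.length + 1) * (8 * N + 19)) + 12 * T + 100 ≤ 4000 * (V.length + T + 2) * (N + 3) := by
      have := Nat.zero_le (V.length * N); have := Nat.zero_le (T * N); nlinarith
    omega
  by_cases hcons : ConsistentL Λ N V f g
  · -- consistent: decide the stars and read off the clause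
    exact (consistentCaseS hΛ hV hC hClen hcons (hsem f g hcons) hW hWlen
      (fun v hv b J h => (hfW b (hpsB v hv b J h)).1) (fun v hv a I h => (hgW a (hhsA v hv a I h)).1)
      hD hB).mono (by unfold caseBudget; omega)
  · -- inconsistent: two units contradict a hole or functionality clause
    have hc1 : ∀ v ∈ V, ∀ b J, Λ.ps v = some (b, J) → f b < N := fun v hv b J h =>
      (hfW b (hpsB v hv b J h)).2
    have hc2 : ∀ v ∈ V, ∀ a I, Λ.hs v = some (a, I) → g a < N + 1 := fun v hv a I h =>
      (hgW a (hhsA v hv a I h)).2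
    unfold ConsistentL at hcons
    simp only [not_and_or] at hcons
    rcases hcons with h | h | h | h | h
    · exact absurd hc1 h
    · exact absurd hc2 h
    · push Not at h
      obtain ⟨v, hv, v', hv', b, J, b', J', hq, hq', hfeq, hne⟩ := h
      obtain ⟨hb, -⟩ := hΛ.1 v b J hq
      obtain ⟨hb', -⟩ := hΛ.1 v' b' J' hq'
      have hS := holeS (N := N) (D := D) (B := B) hne hb hb' (hc1 v hv b J hq) (by omega) (by omega)
      refine refuteCaseS hW hWlen (hfW b (hpsB v hv b J hq)).1 ?_ hddDj hszDj hS hD hBref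
      rw [hfeq]; exact (hfW b' (hpsB v' hv' b' J' hq')).1
    · push Not at h
      obtain ⟨v, hv, v', hv', a, I, a', I', hq, hq', hgeq, hne⟩ := h
      obtain ⟨ha, -⟩ := hΛ.2 v a I hq
      obtain ⟨ha', -⟩ := hΛ.2 v' a' I' hq'
      have hS := funcS (N := N) (D := D) (B := B) (hc2 v hv a I hq) hne ha ha' (by omega) (by omega)
      refine refuteCaseS hW hWlen (hgW a (hhsA v hv a I hq)).1 ?_ hddDj hszDj hS hD hBref
      rw [hgeq]; exact (hgW a' (hhsA v' hv' a' I' hq')).1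
    · push Not at h
      obtain ⟨v, hv, v', hv', b, J, a, I, hq, hq', hiff⟩ := h
      obtain ⟨hb, -⟩ := hΛ.1 v b J hq
      obtain ⟨ha, -⟩ := hΛ.2 v' a I hq'
      have hub := (hfW b (hpsB v hv b J hq)).1
      have hua := (hgW a (hhsA v' hv' a I hq')).1
      rcases hiff with ⟨hfa, hga⟩ | ⟨hfa, hga⟩
      · -- `f b = a` but `g a ≠ b`: pigeons `b ≠ g a` both in hole `a`
        rw [hfa] at hub
        have hne : b ≠ g a := fun e => hga e.symm
        have hS := holeS (N := N) (D := D) (B := B) hne hb (hc2 v' hv' a I hq') ha (by omega) (by omega)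
        exact refuteCaseS hW hWlen hub hua hddDj hszDj hS hD hBref
      · -- `g a = b` but `f b ≠ a`: pigeon `b` in holes `a ≠ f b`
        rw [hga] at hua
        have hS := funcS (N := N) (D := D) (B := B) hb (fun e => hfa e.symm) ha (hc1 v hv b J hq) (by omega) (by omega)
        exact refuteCaseS hW hWlen hua hub hddDj hszDj hS hD hBref


/-! ### A labelled clause from `ontoPHP` -/

/-- `formsCost` is monotone. [folklore] -/
theorem formsCost_mono (N : ℕ) {t t' : ℕ} (h : t ≤ t') : formsCost N t ≤ formsCost N t' := by
  induction t', h using Nat.le_induction with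
  | base => exact le_rfl
  | succ t' _ ih =>
    refine ih.trans ?_
    rw [formsCost_succ]
    have : formsCost N t' ≤ (N + 1) * formsCost N t' := Nat.le_mul_of_pos_left _ (by omega)
    omega


/-- The per-case line budget inside `clauseS` (case, weakening into a context of `≤ P` case
forms, folding the units). [folklore] -/
def caseStep (N Vl P : ℕ) : ℕ :=
  caseBudget N Vl (2 * Vl) + 50 * (P + 2 * Vl + 6 + 1) ^ 2 + (2 * Vl + 1) * (110 * (P + 2 * Vl + 6 + 1) ^ 2)

/-- Line budget of one labelled clause over `Vl` variables: `clauseLines N Vl`. [folklore] -/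
def clauseLines (N Vl : ℕ) : ℕ :=
  formsCost N (2 * Vl) + 50 * ((N + 1) ^ (2 * Vl) + 3 + 1) ^ 2 +
    (N + 1) ^ (2 * Vl) * (caseStep N Vl ((N + 1) ^ (2 * Vl)) + 2) + 50 * (2 + 1) ^ 2

/-- **Folding one settled case into the elimination context**: from `⊢ ¬W, ¬R, Dj` (a case with
units `W`) to `⊢ ¬⋀W, K, ¬R, Dj` for any list `K` of at most `P` case forms.
[cite: KrajicekProofComplexity2019, §15.4 (proof of Lemma 15.4.3: combining the cases)] -/
theorem caseFoldS {W K : List (PropForm ℕ)} {Vl P ZD : ℕ} {Dj : PropForm ℕ}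
    (hW : ∀ w ∈ W, ∃ b a, w = pv N b a) (hWlen : W.length ≤ 2 * Vl)
    (hKlen : K.length ≤ P) (hmsK : msum K ≤ P * (4 * Vl + 2)) (hddK : ∀ Y ∈ K, Y.dd ≤ 2)
    (hddDj : Dj.dd ≤ 6) (hszDj : Dj.size ≤ ZD)
    (hc : BD D B (caseBudget N Vl (2 * Vl)) (disjList ((W.map neg) ++ [neg (ophp N), Dj])))
    (hD : 14 ≤ D) (hB : 1000 * (N + 1) ^ 4 + 16 * (P * (4 * Vl + 2)) + 16 * ZD + 200 * Vl + 400 ≤ B) :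
    BD D B (caseStep N Vl P) (disjList (neg (conjList W) :: (K ++ [neg (ophp N), Dj]))) := by
  have hR := size_ophp_le (N := N)
  have hN4 : N + 1 ≤ (N + 1) ^ 4 := Nat.le_self_pow (by norm_num) _
  have hmsW : msum W = 2 * W.length := msum_atoms hW
  have hmsWn : msum (W.map neg) = 3 * W.length := msum_map_neg_atoms hW
  have hctxdd : ∀ Y ∈ K ++ [neg (ophp N), Dj], Y.dd ≤ 6 := by
    intro Y hY
    simp only [List.mem_append, List.mem_cons, List.not_mem_nil, or_false] at hY
    rcases hY with hY | rfl | rfl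
    · exact (hddK Y hY).trans (by omega)
    · exact dd_neg_ophp_le.trans (by omega)
    · exact hddDj
  -- weaken into the context `K`
  have hw : BD D B (caseBudget N Vl (2 * Vl) + 50 * (P + 2 * Vl + 6 + 1) ^ 2)
      (disjList ((W.map neg) ++ (K ++ [neg (ophp N), Dj]))) := by
    refine subsetN (N := P + 2 * Vl + 6) hc (fun A hA => ?_) (p := 6) ?_ (by omega) ?_ ?_ ?_
    · rcases List.mem_append.1 hA with hA | hA
      · exact List.mem_append_left _ hA
      · exact List.mem_append_right _ (List.mem_append_right _ hA)
    · intro Y hY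
      rcases List.mem_append.1 hY with hY | hY
      · obtain ⟨w, hw, rfl⟩ := List.mem_map.1 hY
        obtain ⟨b, a, rfl⟩ := hW w hw; simp [pv]
      · exact hctxdd Y hY
    · rw [size_disjList_eq_msum, size_disjList_eq_msum, msum_append, msum_append, msum_append, hmsWn,
        msum_cons, msum_cons, msum_nil]
      simp only [size]; omega
    · rw [List.length_append, List.length_map, List.length_cons, List.length_cons, List.length_nil]; omega
    · rw [List.length_append, List.length_append, List.length_map, List.length_cons, List.length_cons,
        List.length_nil]; omega
  -- fold the units
  have hfold := negConjListS (D := D) (B := B) (p := 6) (Nn := P + 2 * Vl + 6) W hw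
    (fun X hX => by
      rcases List.mem_append.1 hX with hX | hX
      · obtain ⟨b, a, rfl⟩ := hW X hX; simp
      · exact hctxdd X hX)
    (fun z hz => by obtain ⟨b, a, rfl⟩ := hW z hz; simp [pv]) (by omega)
    (by rw [List.length_append, List.length_cons, List.length_cons, List.length_nil]; omega)
    (by rw [msum_append, hmsW, msum_cons, msum_cons, msum_nil]; simp only [size]; omega)
  refine hfold.mono ?_
  unfold caseStep
  have : (W.length + 1) * (110 * (P + 2 * Vl + 6 + 1) ^ 2) ≤ (2 * Vl + 1) * (110 * (P + 2 * Vl + 6 + 1) ^ 2) :=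
    Nat.mul_le_mul_right _ (by omega)
  omega

/-- **A labelled clause is derivable from `ontoPHP`.** Let `Λ` be a well-formed simple
PHP-labelling, `V` a duplicate-free variable list and `C` a clause over `V` which is true under
`val Λ f g` for every local bijection `(f, g)` consistent on `V`. Then
`⊢ (clauseOf C)σ, ¬R` has a bounded derivation with `clauseLines N |V|` lines (a polynomial in `N`
of degree `O(|V|)`), every line of disjunct depth `≤ D` (any `D ≥ 14`) and size `≤ B`
(`B ≥ 100 (2|V|+2) (N+1)^{2|V|+2} + 1000 (N+1)^4 + 4000 (3|V|+2)(N+3)`): distribute over the cases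
(`formsS`), settle each case (`caseS`), fold its units (`caseFoldS`) and cut.
[cite: KrajicekProofComplexity2019, §15.4 (Lemma 15.4.3, proof: Claims 1–2 combined)] -/
theorem clauseS (hΛ : Λ.WF N) {V : List ℕ} (hV : V.Nodup) {C : Clause ℕ}
    (hC : ∀ l ∈ C, l.1 ∈ V) (hClen : C.length ≤ V.length)
    (hsem : ∀ f g : ℕ → ℕ, ConsistentL Λ N V f g → (clauseOf C).eval (val Λ f g) = true)
    (hD : 14 ≤ D)
    (hB : 100 * (2 * V.length + 2) * (N + 1) ^ (2 * V.length + 2) + 1000 * (N + 1) ^ 4 +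
      4000 * (3 * V.length + 2) * (N + 3) ≤ B) :
    BD D B (clauseLines N V.length) (disjList [(clauseOf C).subst (sigma Λ N), neg (ophp N)]) := by
  classical
  have hR := size_ophp_le (N := N)
  have hN4 : N + 1 ≤ (N + 1) ^ 4 := Nat.le_self_pow (by norm_num) _
  have hBlen : (pigeonsOf Λ V).length ≤ V.length := length_pigeonsOf_le V
  have hAlen : (holesOf Λ V).length ≤ V.length := length_holesOf_le V
  have hBlN : ∀ b ∈ pigeonsOf Λ V, b < N + 1 := fun b hb => by
    obtain ⟨v, -, J, h⟩ := mem_pigeonsOf_iff.1 hb; exact (hΛ.1 v b J h).1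
  have hAlN : ∀ a ∈ holesOf Λ V, a < N := fun a ha => by
    obtain ⟨v, -, I, h⟩ := mem_holesOf_iff.1 ha; exact (hΛ.2 v a I h).1
  -- sizes and depths of the substituted clause
  have hszC : (clauseOf C).size ≤ 3 * V.length + 1 := (size_clauseOf_le C).trans (by omega)
  have hszDj : ((clauseOf C).subst (sigma Λ N)).size ≤ (3 * V.length + 1) * (8 * N + 19) :=
    (size_subst_le (fun v => size_sigma_le hΛ v) (by omega) _).trans (Nat.mul_le_mul_right _ hszC)
  have hddDj : ((clauseOf C).subst (sigma Λ N)).dd ≤ 6 := by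
    have h1 := altDepthAux_subst_le (σ := sigma Λ N) (T := 4) (fun v c => altDepthAux_sigma_le v c) (clauseOf C) 3
    have h2 : altDepthAux 3 (clauseOf C) ≤ 2 := (altDepthAux_le_altDepth' 3 _).trans (altDepth_clauseOf_le C)
    unfold dd; omega
  -- the case forms
  have hPpow : (N + 1) ^ ((holesOf Λ V).length + (pigeonsOf Λ V).length) ≤ (N + 1) ^ (2 * V.length) :=
    Nat.pow_le_pow_right (by omega) (by omega)
  have hP2 : (N + 1) ^ (2 * V.length) ≤ (N + 1) ^ (2 * V.length + 2) := Nat.pow_le_pow_right (by omega) (by omega)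
  have hFlen : (forms N (pigeonsOf Λ V) (holesOf Λ V)).length ≤ (N + 1) ^ (2 * V.length) :=
    (length_forms_le _ _).trans hPpow
  have hmsF : msum (forms N (pigeonsOf Λ V) (holesOf Λ V)) ≤ (N + 1) ^ (2 * V.length) * (4 * V.length + 2) :=
    (msum_forms_le _ _).trans (Nat.mul_le_mul hPpow (by omega))
  have hddF : ∀ φ ∈ forms N (pigeonsOf Λ V) (holesOf Λ V), φ.dd ≤ 2 := fun φ hφ => by
    obtain ⟨gl, fl, -, -, -, -, rfl⟩ := exists_of_mem_forms hφ
    exact dd_conjList_atoms fun w hw => caseUnits_atom hw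
  -- Step 1: some case holds: `⊢ forms, ¬R` (before the powers are abstracted)
  have h1 : BD D B (formsCost N (2 * V.length)) (disjList (forms N (pigeonsOf Λ V) (holesOf Λ V) ++ [neg (ophp N)])) :=
    (formsS (N := N) (D := D) (B := B) (T := 2 * V.length) hBlN (by omega)
      (le_trans (Nat.le_add_right _ _) hB) (holesOf Λ V) hAlN (by omega)).mono (formsCost_mono N (by omega))
  -- abstract the two powers of `N + 1` (linear arithmetic below treats them as atoms)
  unfold clauseLines
  generalize hPw : (N + 1) ^ (2 * V.length) = Pw at hFlen hmsF hP2 ⊢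
  generalize hPw2 : (N + 1) ^ (2 * V.length + 2) = Pw2 at hB hP2
  clear hPw hPw2 hPpow
  -- arithmetic, isolated
  have hDjB : 16 * ((3 * V.length + 1) * (8 * N + 19)) + 200 * V.length + 400 ≤
      4000 * (3 * V.length + 2) * (N + 3) := by
    have := Nat.zero_le (V.length * N); nlinarith
  have hPB : 16 * (Pw * (4 * V.length + 2)) ≤ 100 * (2 * V.length + 2) * Pw2 := by
    have : Pw * (4 * V.length + 2) ≤ Pw2 * (4 * V.length + 2) := Nat.mul_le_mul_right _ hP2
    nlinarith
  have hBfold : 1000 * (N + 1) ^ 4 + 16 * (Pw * (4 * V.length + 2)) +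
      16 * ((3 * V.length + 1) * (8 * N + 19)) + 200 * V.length + 400 ≤ B := by linarith
  have hBcase : 1000 * (N + 1) ^ 4 + 4000 * (V.length + 2 * V.length + 2) * (N + 3) ≤ B := by
    have e : V.length + 2 * V.length + 2 = 3 * V.length + 2 := by omega
    rw [e]; linarith
  -- Step 2: `⊢ forms, ¬R, Dj`
  have h2 := subsetN (N := Pw + 3)
    (L' := forms N (pigeonsOf Λ V) (holesOf Λ V) ++ [neg (ophp N), (clauseOf C).subst (sigma Λ N)])
    h1 (fun A hA => ?_) (p := 6) ?_ (by linarith) ?_ ?_ ?_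
  rotate_left
  · rcases List.mem_append.1 hA with hA | hA
    · exact List.mem_append_left _ hA
    · rw [List.mem_singleton] at hA; subst hA; simp
  · intro X hX
    simp only [List.mem_append, List.mem_cons, List.not_mem_nil, or_false] at hX
    rcases hX with hX | rfl | rfl
    · exact (hddF X hX).trans (by linarith)
    · exact dd_neg_ophp_le.trans (by linarith)
    · exact hddDj
  · rw [size_disjList_eq_msum, size_disjList_eq_msum, msum_append, msum_append, msum_cons, msum_cons,
      msum_cons, msum_nil]
    simp only [size]; linarith
  · rw [List.length_append, List.length_singleton]; linarith
  · rw [List.length_append, List.length_cons, List.length_cons, List.length_nil]; linarith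
  -- Step 3: eliminate the cases
  have h3 := elimAllS (forms N (pigeonsOf Λ V) (holesOf Λ V)) h2
    (L := [neg (ophp N), (clauseOf C).subst (sigma Λ N)]) (m := caseStep N V.length Pw) ?_ ?_
  rotate_left
  · intro φ hφ K hK
    obtain ⟨gl, fl, hgl, hfl, hgN, hfN, rfl⟩ := exists_of_mem_forms hφ
    have hc := caseS (N := N) (D := D) (B := B) hΛ hV hC hClen hsem hgl hfl hgN hfN (T := 2 * V.length)
      (by linarith) hD hBcase
    exact caseFoldS (fun w hw => caseUnits_atom hw)
      ((length_caseUnits_le (N := N) _ _ gl fl).trans (by linarith)) (hK.length_le.trans hFlen)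
      ((msum_le_of_sublist hK.sublist).trans hmsF) (fun Y hY => hddF Y (hK.subset hY)) hddDj hszDj hc hD hBfold
  · rw [size_disjList_eq_msum, msum_append, msum_cons, msum_cons, msum_nil]
    simp only [size]; linarith
  -- Step 4: swap to `⊢ Dj, ¬R`
  have h4 := subsetN (N := 2) (L' := [(clauseOf C).subst (sigma Λ N), neg (ophp N)]) h3 (fun A hA => ?_)
    (p := 6) ?_ (by linarith) ?_ (by simp) (by simp)
  rotate_left
  · simp only [List.mem_cons, List.not_mem_nil, or_false] at hA
    rcases hA with rfl | rfl
    · exact List.mem_cons_of_mem _ (List.mem_singleton_self _)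
    · exact List.mem_cons_self
  · intro X hX
    simp only [List.mem_cons, List.not_mem_nil, or_false] at hX
    rcases hX with rfl | rfl
    · exact hddDj
    · exact dd_neg_ophp_le.trans (by linarith)
  · rw [size_disjList_eq_msum, size_disjList_eq_msum, msum_cons, msum_cons, msum_cons, msum_cons, msum_nil]
    simp only [size]; linarith
  refine h4.mono ?_
  have : (forms N (pigeonsOf Λ V) (holesOf Λ V)).length * (caseStep N V.length Pw + 2) ≤
      Pw * (caseStep N V.length Pw + 2) := Nat.mul_le_mul_right _ hFlen
  linarith

end OntoPHPReduction

end Literature.Computability.MetaComplexity
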